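import Literature.Geometry.Kaehler.HolomorphicChainCarrierProduct
import Literature.Analysis.Calculus.AreaFormulaHausdorff
import Literature.Analysis.Complex.PositiveForms
import Mathlib.MeasureTheory.Measure.Haar.InnerProductSpace
import HarnessLib

/-!
# Integration over the sheets of a holomorphic chain, II: general forms and the local coarea
# formula over a product

Layer `Literature/Geometry/Kaehler`, namespace `Literature.Geometry.Kaehler.HolomorphicChain`; lane
`lit-hodgefound`, seat p07, programme «THE ANALYTIC CLASSES OF A COMPLEX TORUS FORM A RING», file 2
(file 1: `ComplexTorusAnalyticClassesCupProductReduction.lean`). The setting is that of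
`ChainSheetFormula.lean`: `T` a holomorphic `p`-chain on an open `Ω ⊆ V`, `ℓ : V → P` complex-linear
onto a `p`-dimensional complex inner product space and `s : W → V` a holomorphic SECTION of `ℓ` over
the open `W ⊆ P` parametrising a relatively open piece of the carrier (`ℓ (s w) = w`,
`s(W) ⊆ reg|T|`, the carrier near `s w` lies in `s(W)`), a *sheet*.

* §1 **The sheet formula for arbitrary forms and weights** (`integral_image_section_eq`,
  `lintegral_image_section_eq_enorm`, `integrableOn_image_section_iff`): for every field `ω` of
  complex `2p`-covectors on `V`, every weight `g : V → ℂ` and every unitary frame `u` of `P`,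
  `∫_{s(S)} g ω(ξ_T) d𝓗^{2p} = ∫_S g(s w) ω(s w)(Ds(w) u₀, Ds(w) iu₀, …) d𝓗^{2p}(w)`:
  the area formula [Federer1969, 3.2.5] for the injective immersion `s`, the identification of
  `ξ_T(s w)` with the canonical orientation of `im Ds(w)` [Chirka1989, §14.1] and the Jacobian identity
  `ω(Ds ∘ (e, ie)) = J_{2p}(Ds) ω(ξ)` (`apply_comp_complexFrame_eq_normDet_mul`). The special case
  `ω = ℓ^*Φ` is `ChainSheetFormula.lintegral_image_section_eq`.
* §2 **Block evaluation** (`wedge_compContinuousLinearMap_apply_append`): for `ℝ`-linear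
  `P₁ : V → V₁`, `P₂ : V → V₂`, `(P₁^*γ ∧ P₂^*ν)(v ⊔ c) = γ(P₁ v) · ν(P₂ c)` as soon as `P₂` kills the
  block `v` (the shuffle formula, [Warner1983, 2.10 (b)]; Demailly Ch. III (1.6)).
* §3 **The local coarea formula for a sheet adapted to a product** (`integral_image_section_cross_eq`,
  `lintegral_image_section_cross_eq_enorm`): `V = V₁ ⊞ V₂`, `P = K ⊞ V₂` (`⊞ = WithLp 2 (· × ·)`),
  `ℓ(x, y) = (ℓ₁ x, y)`, `γ ∈ Alt^{2a}(V₁)`, `ν ∈ Alt^{2b}(V₂)` with `a = dim K`, `b = dim V₂`,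
  `a + b = p`; then for the cross form `Ω = pr₁^*γ ∧ pr₂^*ν` (read in degree `2p` on `V₁ ⊞ V₂`)
  `∫_{s(S)} g Ω(ξ_T) d𝓗^{2p} = ν(e₂, ie₂, …) ∫_{t ∈ V₂} ∫_{S_t} g(s(x,t)) γ((D s(x,t)(e′ᵢ, 0))₁, …) d𝓗^{2a}(x) d𝓗^{2b}(t)`,
  `S_t = {x : (x, t) ∈ S}` — Fubini on `K ⊞ V₂` after §1–§2 (`P₂ ∘ Ds = pr₂`, so the `ν`-factor only
  sees the `V₂`-block of the concatenated unitary frame). This is the chart-level form of the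
  coarea / fibre-integration formula `∫_A pr₁^*γ ∧ pr₂^*dvol = ∫_t (∫_{A_t} γ) dt`
  [Federer1969, 3.2.22; Chirka1989, §14.2] used in file 3 for analytic subsets of `X₁ × X₂`;
  `integrableOn_preimage_toLp_cross_integrand` (integrability of the fibre integrand, for Fubini) and
  `map_toLp_prod_euclideanHausdorffMeasure` (`𝓗^{n+n'}` on `U ⊞ U'` is `𝓗ⁿ ⊗ 𝓗^{n'}`).
* §4 **Slices of an adapted sheet** (`slice_image_section_eq`, `hasFDerivAt_slice_section`,
  `differentiableOn_slice_section`): `{x : (x, t) ∈ s(S)} = s_t(S_t)` for the slice sections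
  `s_t(x′) = (s(x′, t))₁`, holomorphic with `D s_t(x′) h = (Ds(x′, t)(h, 0))₁` — the data to which
  §1 is applied on the slice chains in file 3.

Theorems only; no definitions, no named facts.

## References

* [Federer1969] H. Federer, *Geometric Measure Theory*, Springer 1969, 3.2.3, 3.2.5, 3.2.22, 3.2.23.
* [Chirka1989] E. M. Chirka, *Complex Analytic Sets*, Kluwer 1989, §14.1 (Wirtinger, Lemma 1 and
  Cor. p. 174), §14.2.
* [Warner1983] F. Warner, *Foundations of Differentiable Manifolds and Lie Groups*, Springer 1983, 2.10.
* [DemaillyAGBook] J.-P. Demailly, *Complex Analytic and Differential Geometry*, Ch. III §1 (1.6).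
-/

noncomputable section

open scoped Manifold Topology ENNReal NNReal InnerProductSpace
open Set Filter MeasureTheory MeasureTheory.Measure Metric Module Function WithLp

universe u

namespace Literature.Geometry.Kaehler

open Literature.Geometry.GeometricMeasureTheory

-- Nested operator-norm instances on `Covector V m`, as in `Currents.lean`.
set_option maxSynthPendingDepth 2

/-! ### §0 Linear algebra of complex frames -/

section Frames

variable {V : Type*} [NormedAddCommGroup V] [InnerProductSpace ℂ V] {p p' : ℕ}

/-- Reindexing a complex frame along an equation of lengths reindexes its real frame. [folklore] -/
private theorem complexFrame_comp_cast (u : Fin p → V) (h : p' = p) :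
    complexFrame (u ∘ Fin.cast h) = complexFrame u ∘ Fin.cast (congrArg (2 * ·) h) := by
  subst h
  rfl

/-- **The Jacobian identity for complex-valued covectors**: for complex-linear `D : T₀ → V`, a
unitary basis `b` of `T₀` and a unitary frame `u'` of `im D`,
`ω(D b₀, D ib₀, …) = J_{2p}(D) · ω(u'₀, iu'₀, …)` for every complex-valued real `2p`-covector `ω`
(`apply_comp_complexFrame_eq_normDet_mul` on real and imaginary parts).
[cite: Chirka1989, §14.1 Lemma 1] -/
theorem apply_comp_complexFrame_eq_normDet_mul_complex {T₀ : Type*} [NormedAddCommGroup T₀]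
    [InnerProductSpace ℂ T₀] [FiniteDimensional ℂ T₀] [FiniteDimensional ℂ V]
    (b : OrthonormalBasis (Fin p) ℂ T₀) (D : T₀ →L[ℂ] V)
    {u' : Fin p → V} (hu' : Orthonormal ℂ u')
    (hspan : (Submodule.span ℝ (range (complexFrame u')) : Set V) = range D)
    (ω : V [⋀^Fin (2 * p)]→L[ℝ] ℂ) :
    letI : InnerProductSpace ℝ T₀ := InnerProductSpace.complexToReal
    letI : InnerProductSpace ℝ V := InnerProductSpace.complexToReal
    ω (⇑D ∘ complexFrame b) =
      (((D.restrictScalars ℝ : T₀ →L[ℝ] V) : T₀ →ₗ[ℝ] V).normDet : ℂ) * ω (complexFrame u') := by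
  letI : InnerProductSpace ℝ T₀ := InnerProductSpace.complexToReal
  letI : InnerProductSpace ℝ V := InnerProductSpace.complexToReal
  apply Complex.ext
  · have h := apply_comp_complexFrame_eq_normDet_mul b D hu' hspan
      (Complex.reCLM.compContinuousAlternatingMap ω)
    simp only [ContinuousLinearMap.compContinuousAlternatingMap_coe, Function.comp_apply,
      Complex.reCLM_apply] at h
    rw [h, Complex.re_ofReal_mul]
  · have h := apply_comp_complexFrame_eq_normDet_mul b D hu' hspan
      (Complex.imCLM.compContinuousAlternatingMap ω)
    simp only [ContinuousLinearMap.compContinuousAlternatingMap_coe, Function.comp_apply,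
      Complex.imCLM_apply] at h
    rw [h, Complex.im_ofReal_mul]

end Frames

/-! ### §1 The sheet formula for arbitrary forms and weights -/

variable {V : Type u} [NormedAddCommGroup V] [InnerProductSpace ℂ V] [FiniteDimensional ℂ V]
  [MeasurableSpace V] [BorelSpace V] {Ω : TopologicalSpace.Opens V} {p : ℕ}
  {P : Type*} [NormedAddCommGroup P] [InnerProductSpace ℂ P] [FiniteDimensional ℂ P]
  [MeasurableSpace P] [BorelSpace P]

namespace HolomorphicChain

/-- `exists_orientationFrame_eq_of_section` in dimension `p > 0` (rather than `q + 1`).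
[cite: Chirka1989, §14.1, p. 174] -/
theorem exists_orientationFrame_eq_of_section' (hp : 0 < p) (T : HolomorphicChain 𝓘(ℂ, V) Ω p)
    (hP : finrank ℂ P = p) (ℓ : V →L[ℂ] P) {W : Set P} (hW : IsOpen W) {s : P → V}
    (hs : DifferentiableOn ℂ s W) (hℓs : ∀ w ∈ W, ℓ (s w) = w) (hsW : s '' W ⊆ T.carrier) {t : P}
    (ht : t ∈ W) {N : Set V} (hN : N ∈ 𝓝 (s t)) (hNc : T.carrier ∩ N ⊆ s '' W) :
    ∃ u : Fin p → V, Orthonormal ℂ u ∧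
      ((Submodule.span ℝ (Set.range (complexFrame u)) : Set V) = Set.range (fderiv ℂ s t)) ∧
      T.orientationFrame (s t) = complexFrame u := by
  obtain ⟨q, rfl⟩ : ∃ q, p = q + 1 := ⟨p - 1, by omega⟩
  exact T.exists_orientationFrame_eq_of_section hP ℓ hW hs hℓs hsW ht hN hNc

/-- **Jacobian cancellation for an arbitrary covector**: at a sheet point `s t`, for every unitary
frame `u` of `P` and every complex `2p`-covector `ω` on `V`,
`J_{2p}(Ds(t)) · ω(ξ_T(s t)) = ω(Ds(t) u₀, Ds(t) iu₀, …)` (`J_{2p}` the real Jacobian `normDet` of the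
realification). [cite: Federer1969, 3.2.5] [cite: Chirka1989, §14.1 Lemma 1 and Cor. p. 174] -/
theorem normDet_mul_apply_orientationFrame_of_section (hp : 0 < p) (T : HolomorphicChain 𝓘(ℂ, V) Ω p)
    (hP : finrank ℂ P = p) (ℓ : V →L[ℂ] P) {W : Set P} (hW : IsOpen W) {s : P → V}
    (hs : DifferentiableOn ℂ s W) (hℓs : ∀ w ∈ W, ℓ (s w) = w) (hsW : s '' W ⊆ T.carrier) {t : P}
    (ht : t ∈ W) {N : Set V} (hN : N ∈ 𝓝 (s t)) (hNc : T.carrier ∩ N ⊆ s '' W)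
    {u : Fin p → P} (hu : Orthonormal ℂ u) (ω : V [⋀^Fin (2 * p)]→L[ℝ] ℂ) :
    letI : InnerProductSpace ℝ P := InnerProductSpace.complexToReal
    letI : InnerProductSpace ℝ V := InnerProductSpace.complexToReal
    ((((fderiv ℂ s t).restrictScalars ℝ : P →L[ℝ] V) : P →ₗ[ℝ] V).normDet : ℂ) *
        ω (T.orientationFrame (s t)) = ω (⇑(fderiv ℂ s t) ∘ complexFrame u) := by
  letI : InnerProductSpace ℝ P := InnerProductSpace.complexToReal
  letI : InnerProductSpace ℝ V := InnerProductSpace.complexToReal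
  -- `u` is a unitary basis
  haveI : Nonempty (Fin p) := ⟨⟨0, hp⟩⟩
  have hcard : Fintype.card (Fin p) = finrank ℂ P := by rw [Fintype.card_fin, hP]
  have hsp : ⊤ ≤ Submodule.span ℂ (Set.range u) := by
    have h := (basisOfOrthonormalOfCardEqFinrank hu hcard).span_eq
    rw [coe_basisOfOrthonormalOfCardEqFinrank] at h
    exact h.symm.le
  set b : OrthonormalBasis (Fin p) ℂ P := OrthonormalBasis.mk hu hsp with hb
  have hbu : ⇑b = u := by simp [hb]
  obtain ⟨u', hu', hspan, hξ⟩ :=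
    T.exists_orientationFrame_eq_of_section' hp hP ℓ hW hs hℓs hsW ht hN hNc
  rw [hξ, ← hbu, apply_comp_complexFrame_eq_normDet_mul_complex b (fderiv ℂ s t) hu' hspan ω]

/-- **The sheet formula for an arbitrary covector field and weight (Bochner form).** For a
holomorphic section `s` of `ℓ` over the open `W ⊆ P` parametrising a relatively open piece of the
carrier of the `p`-chain `T` (`p = dim_ℂ P > 0`), a unitary frame `u` of `P`, a measurable `S ⊆ W`,
any `ω : V → Alt^{2p}_ℝ(V; ℂ)` and any `g : V → ℂ`:
`∫_{s(S)} g ω(ξ_T) d𝓗^{2p} = ∫_S g(s w) ω(s w)(Ds(w) u₀, Ds(w) iu₀, …) d𝓗^{2p}(w)` — the change of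
variables [Federer1969, 3.2.5] for the injective immersion `s` (no integrability needed: both sides
vanish together otherwise) combined with the Jacobian cancellation. [cite: Federer1969, 3.2.5]
[cite: Chirka1989, §14.1 Cor., p. 174] -/
theorem integral_image_section_eq (hp : 0 < p) (T : HolomorphicChain 𝓘(ℂ, V) Ω p)
    (hP : finrank ℂ P = p) (ℓ : V →L[ℂ] P) {W : Set P} (hW : IsOpen W) {s : P → V}
    (hs : DifferentiableOn ℂ s W) (hℓs : ∀ w ∈ W, ℓ (s w) = w) (hsW : s '' W ⊆ T.carrier)
    (hopen : ∀ t ∈ W, ∃ N ∈ 𝓝 (s t), T.carrier ∩ N ⊆ s '' W)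
    {u : Fin p → P} (hu : Orthonormal ℂ u) (ω : V → V [⋀^Fin (2 * p)]→L[ℝ] ℂ) (g : V → ℂ)
    {S : Set P} (hSm : MeasurableSet S) (hSW : S ⊆ W) :
    ∫ z in s '' S, g z * ω z (T.orientationFrame z) ∂(μHE[2 * p] : Measure V) =
      ∫ w in S, g (s w) * ω (s w) (⇑(fderiv ℂ s w) ∘ complexFrame u) ∂(μHE[2 * p] : Measure P) := by
  letI : InnerProductSpace ℝ P := InnerProductSpace.complexToReal
  letI : InnerProductSpace ℝ V := InnerProductSpace.complexToReal
  have h2p : finrank ℝ P = 2 * p := by rw [finrank_real_of_complex, hP]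
  have hvol : (μHE[2 * p] : Measure P) = volume := by
    rw [← h2p]; exact InnerProductSpace.euclideanHausdorffMeasure_eq_volume
  have hf' : ∀ x ∈ S, HasFDerivWithinAt s ((fderiv ℂ s x).restrictScalars ℝ) S x := fun x hx ↦
    (((hs.differentiableAt (hW.mem_nhds (hSW hx))).hasFDerivAt).restrictScalars ℝ).hasFDerivWithinAt
  have hinj : ∀ x ∈ S, Injective ((fderiv ℂ s x).restrictScalars ℝ) := fun x hx ↦
    injective_fderiv_of_section ℓ hW hs hℓs (hSW hx)
  have hli : LeftInvOn ℓ s W := hℓs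
  have hinjOn : InjOn s S := hli.injOn.mono hSW
  have key := Literature.Analysis.Calculus.integral_image_eq_integral_normDet_smul hSm hf' hinj hinjOn
    (fun z ↦ g z * ω z (T.orientationFrame z))
  rw [h2p] at key
  rw [key, hvol]
  refine setIntegral_congr_fun hSm fun x hx ↦ ?_
  obtain ⟨N, hN, hNc⟩ := hopen x (hSW hx)
  rw [← T.normDet_mul_apply_orientationFrame_of_section hp hP ℓ hW hs hℓs hsW (hSW hx) hN hNc hu (ω (s x)),
    Complex.real_smul]
  ring

/-- **The sheet formula, `∫⁻` form with extended norms**: for any `G : V → [0, ∞]`,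
`∫⁻_{s(S)} G ‖ω(ξ_T)‖ₑ d𝓗^{2p} = ∫⁻_S G(s w) ‖ω(s w)(Ds(w) u₀, …)‖ₑ d𝓗^{2p}(w)` (no measurability needed).
[cite: Federer1969, 3.2.5] [cite: Chirka1989, §14.1 Cor., p. 174] -/
theorem lintegral_image_section_eq_enorm (hp : 0 < p) (T : HolomorphicChain 𝓘(ℂ, V) Ω p)
    (hP : finrank ℂ P = p) (ℓ : V →L[ℂ] P) {W : Set P} (hW : IsOpen W) {s : P → V}
    (hs : DifferentiableOn ℂ s W) (hℓs : ∀ w ∈ W, ℓ (s w) = w) (hsW : s '' W ⊆ T.carrier)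
    (hopen : ∀ t ∈ W, ∃ N ∈ 𝓝 (s t), T.carrier ∩ N ⊆ s '' W)
    {u : Fin p → P} (hu : Orthonormal ℂ u) (ω : V → V [⋀^Fin (2 * p)]→L[ℝ] ℂ) (G : V → ℝ≥0∞)
    {S : Set P} (hSm : MeasurableSet S) (hSW : S ⊆ W) :
    ∫⁻ z in s '' S, G z * ‖ω z (T.orientationFrame z)‖ₑ ∂(μHE[2 * p] : Measure V) =
      ∫⁻ w in S, G (s w) * ‖ω (s w) (⇑(fderiv ℂ s w) ∘ complexFrame u)‖ₑ ∂(μHE[2 * p] : Measure P) := by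
  letI : InnerProductSpace ℝ P := InnerProductSpace.complexToReal
  letI : InnerProductSpace ℝ V := InnerProductSpace.complexToReal
  have h2p : finrank ℝ P = 2 * p := by rw [finrank_real_of_complex, hP]
  have hvol : (μHE[2 * p] : Measure P) = volume := by
    rw [← h2p]; exact InnerProductSpace.euclideanHausdorffMeasure_eq_volume
  have hf' : ∀ x ∈ S, HasFDerivWithinAt s ((fderiv ℂ s x).restrictScalars ℝ) S x := fun x hx ↦
    (((hs.differentiableAt (hW.mem_nhds (hSW hx))).hasFDerivAt).restrictScalars ℝ).hasFDerivWithinAt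
  have hinj : ∀ x ∈ S, Injective ((fderiv ℂ s x).restrictScalars ℝ) := fun x hx ↦
    injective_fderiv_of_section ℓ hW hs hℓs (hSW hx)
  have hli : LeftInvOn ℓ s W := hℓs
  have hinjOn : InjOn s S := hli.injOn.mono hSW
  have key := Literature.Analysis.Calculus.lintegral_image_eq_lintegral_normDet_mul hSm hf' hinj hinjOn
    (fun z ↦ G z * ‖ω z (T.orientationFrame z)‖ₑ)
  rw [h2p] at key
  rw [key, hvol]
  refine setLIntegral_congr_fun hSm fun x hx ↦ ?_
  obtain ⟨N, hN, hNc⟩ := hopen x (hSW hx)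
  have hnd := T.normDet_mul_apply_orientationFrame_of_section hp hP ℓ hW hs hℓs hsW (hSW hx) hN hNc hu
    (ω (s x))
  rw [← hnd, enorm_mul, ← ofReal_norm ((((fderiv ℂ s x).restrictScalars ℝ : P →L[ℝ] V) :
      P →ₗ[ℝ] V).normDet : ℂ), Complex.norm_real, Real.norm_eq_abs,
    abs_of_nonneg (LinearMap.normDet_nonneg _)]
  ring

/-- **Integrability in the sheet formula**: `g ω(ξ_T)` is `𝓗^{2p}`-integrable on `s(S)` iff
`g(s w) ω(s w)(Ds(w) u₀, …)` is `𝓗^{2p}`-integrable on `S`. [cite: Federer1969, 3.2.5] -/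
theorem integrableOn_image_section_iff (hp : 0 < p) (T : HolomorphicChain 𝓘(ℂ, V) Ω p)
    (hP : finrank ℂ P = p) (ℓ : V →L[ℂ] P) {W : Set P} (hW : IsOpen W) {s : P → V}
    (hs : DifferentiableOn ℂ s W) (hℓs : ∀ w ∈ W, ℓ (s w) = w) (hsW : s '' W ⊆ T.carrier)
    (hopen : ∀ t ∈ W, ∃ N ∈ 𝓝 (s t), T.carrier ∩ N ⊆ s '' W)
    {u : Fin p → P} (hu : Orthonormal ℂ u) (ω : V → V [⋀^Fin (2 * p)]→L[ℝ] ℂ) (g : V → ℂ)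
    {S : Set P} (hSm : MeasurableSet S) (hSW : S ⊆ W) :
    IntegrableOn (fun z ↦ g z * ω z (T.orientationFrame z)) (s '' S) (μHE[2 * p] : Measure V) ↔
      IntegrableOn (fun w ↦ g (s w) * ω (s w) (⇑(fderiv ℂ s w) ∘ complexFrame u)) S
        (μHE[2 * p] : Measure P) := by
  letI : InnerProductSpace ℝ P := InnerProductSpace.complexToReal
  letI : InnerProductSpace ℝ V := InnerProductSpace.complexToReal
  have h2p : finrank ℝ P = 2 * p := by rw [finrank_real_of_complex, hP]
  have hvol : (μHE[2 * p] : Measure P) = volume := by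
    rw [← h2p]; exact InnerProductSpace.euclideanHausdorffMeasure_eq_volume
  have hf' : ∀ x ∈ S, HasFDerivWithinAt s ((fderiv ℂ s x).restrictScalars ℝ) S x := fun x hx ↦
    (((hs.differentiableAt (hW.mem_nhds (hSW hx))).hasFDerivAt).restrictScalars ℝ).hasFDerivWithinAt
  have hinj : ∀ x ∈ S, Injective ((fderiv ℂ s x).restrictScalars ℝ) := fun x hx ↦
    injective_fderiv_of_section ℓ hW hs hℓs (hSW hx)
  have hli : LeftInvOn ℓ s W := hℓs
  have hinjOn : InjOn s S := hli.injOn.mono hSW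
  have key := Literature.Analysis.Calculus.integrableOn_image_iff_integrableOn_normDet_smul hSm hf' hinj
    hinjOn (fun z ↦ g z * ω z (T.orientationFrame z))
  rw [h2p] at key
  rw [key, hvol]
  refine integrableOn_congr_fun (fun x hx ↦ ?_) hSm
  obtain ⟨N, hN, hNc⟩ := hopen x (hSW hx)
  rw [← T.normDet_mul_apply_orientationFrame_of_section hp hP ℓ hW hs hℓs hsW (hSW hx) hN hNc hu (ω (s x)),
    Complex.real_smul]
  ring

end HolomorphicChain

/-! ### §2 Block evaluation of cross products -/

section Block

variable {Y : Type*} [NormedAddCommGroup Y] [NormedSpace ℂ Y]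
  {V₁ : Type*} [NormedAddCommGroup V₁] [NormedSpace ℝ V₁]
  {V₂ : Type*} [NormedAddCommGroup V₂] [NormedSpace ℝ V₂] {m k : ℕ}

/-- **Block evaluation of a cross product**: for `ℝ`-linear `P₁ : Y → V₁`, `P₂ : Y → V₂`, vectors
`v₀, …, v_{m-1}` KILLED by `P₂` and arbitrary `c₀, …, c_{k-1}`,
`(P₁^*γ ∧ P₂^*ν)(v ⊔ c) = γ(P₁ v) · ν(P₂ c)`: in the shuffle formula [Warner1983, 2.10 (b)] every summand
placing some `vᵢ` in the `ν`-slot vanishes, and the surviving block permutations give `γ(P₁ v) ν(P₂ c)`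
(Demailly, proof of Criterion III.1.6). [cite: Warner1983, 2.10 (b)] [cite: DemaillyAGBook, Ch. III Criterion 1.6 (proof)] -/
theorem wedge_compContinuousLinearMap_apply_append (γ : V₁ [⋀^Fin m]→L[ℝ] ℂ) (ν : V₂ [⋀^Fin k]→L[ℝ] ℂ)
    (P₁ : Y →L[ℝ] V₁) (P₂ : Y →L[ℝ] V₂) (v : Fin m → Y) (c : Fin k → Y) (hv : ∀ i, P₂ (v i) = 0) :
    (γ.compContinuousLinearMap P₁).wedge (ν.compContinuousLinearMap P₂) (Fin.append v c) =
      γ (⇑P₁ ∘ v) * ν (⇑P₂ ∘ c) := by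
  rw [Literature.Analysis.Complex.PositiveForm.wedge_apply_append_of_forall]
  · rfl
  · intro w j i hji
    rw [ContinuousAlternatingMap.compContinuousLinearMap_apply]
    exact (ν : V₂ [⋀^Fin k]→L[ℝ] ℂ).map_coord_zero j (by simp [hji, hv i])

end Block

/-! ### §3 The local coarea formula for a sheet adapted to a product -/

section ProdMeasure

variable {U U' : Type*} [NormedAddCommGroup U] [InnerProductSpace ℝ U] [FiniteDimensional ℝ U]
  [MeasurableSpace U] [BorelSpace U] [NormedAddCommGroup U'] [InnerProductSpace ℝ U']
  [FiniteDimensional ℝ U'] [MeasurableSpace U'] [BorelSpace U']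

/-- **`𝓗^{n+n'}` on `U ⊞ U'` is the product of `𝓗ⁿ` on `U` and `𝓗^{n'}` on `U'`** (`n`, `n'` the
dimensions; all three are Lebesgue measures, Mathlib `WithLp.volume_preserving_toLp`).
[cite: Federer1969, 3.2.23] -/
theorem map_toLp_prod_euclideanHausdorffMeasure :
    (((μHE[finrank ℝ U] : Measure U).prod (μHE[finrank ℝ U'] : Measure U')).map (toLp 2) :
        Measure (WithLp 2 (U × U'))) = μHE[finrank ℝ U + finrank ℝ U'] := by
  have h : finrank ℝ (WithLp 2 (U × U')) = finrank ℝ U + finrank ℝ U' := by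
    rw [(WithLp.linearEquiv 2 ℝ (U × U')).finrank_eq, Module.finrank_prod]
  rw [InnerProductSpace.euclideanHausdorffMeasure_eq_volume,
    InnerProductSpace.euclideanHausdorffMeasure_eq_volume, ← h,
    InnerProductSpace.euclideanHausdorffMeasure_eq_volume]
  exact (WithLp.volume_preserving_toLp U U').map_eq

end ProdMeasure

namespace HolomorphicChain

variable {V₁ : Type u} [NormedAddCommGroup V₁] [InnerProductSpace ℂ V₁] [FiniteDimensional ℂ V₁]
  [MeasurableSpace V₁] [BorelSpace V₁]
  {V₂ : Type u} [NormedAddCommGroup V₂] [InnerProductSpace ℂ V₂] [FiniteDimensional ℂ V₂]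
  [MeasurableSpace V₂] [BorelSpace V₂]
  {K : Type u} [NormedAddCommGroup K] [InnerProductSpace ℂ K] [FiniteDimensional ℂ K]
  [MeasurableSpace K] [BorelSpace K]
  {Ω' : TopologicalSpace.Opens (WithLp 2 (V₁ × V₂))} {a b : ℕ}

omit [FiniteDimensional ℂ V₁] [MeasurableSpace V₁] [BorelSpace V₁] [FiniteDimensional ℂ V₂] [MeasurableSpace V₂]
  [BorelSpace V₂] [FiniteDimensional ℂ K] [MeasurableSpace K] [BorelSpace K] in
/-- For a section `s` of a map `ℓ` preserving the second coordinate of `V₁ ⊞ V₂`, the differential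
`Ds(w)` also preserves it: `(Ds(w) ζ)₂ = ζ₂` (`ℓ ∘ Ds(w) = id`). [folklore] -/
private theorem snd_fderiv_section_apply (ℓ : WithLp 2 (V₁ × V₂) →L[ℂ] WithLp 2 (K × V₂))
    (hℓ₂ : ∀ z, (ofLp (ℓ z)).2 = (ofLp z).2) {W : Set (WithLp 2 (K × V₂))} (hW : IsOpen W)
    {s : WithLp 2 (K × V₂) → WithLp 2 (V₁ × V₂)} (hs : DifferentiableOn ℂ s W)
    (hℓs : ∀ w ∈ W, ℓ (s w) = w) {w : WithLp 2 (K × V₂)} (hw : w ∈ W) (ζ : WithLp 2 (K × V₂)) :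
    (ofLp (fderiv ℂ s w ζ)).2 = (ofLp ζ).2 := by
  rw [← hℓ₂ (fderiv ℂ s w ζ), comp_fderiv_eq_of_section ℓ hW hs hℓs hw ζ]

omit [FiniteDimensional ℂ V₁] [MeasurableSpace V₁] [BorelSpace V₁] [FiniteDimensional ℂ V₂] [MeasurableSpace V₂]
  [BorelSpace V₂] [FiniteDimensional ℂ K] [MeasurableSpace K] [BorelSpace K] in
/-- **The cross form on the differential of an adapted section**: with the concatenated unitary
frame `u = ((e′, 0) ⊔ (0, e₂))` of `K ⊞ V₂`,
`(pr₁^*γ ∧ pr₂^*ν)(Ds(w) u₀, Ds(w) iu₀, …) = γ((Ds(w)(e′₀, 0))₁, (Ds(w)(ie′₀, 0))₁, …) · ν(e₂, ie₂, …)`: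
`Ds(w)` maps `(h, 0)` into `V₁ × 0` and `(0, y)` to `(∗, y)`, and §2 applies.
[cite: Warner1983, 2.10 (b)] [cite: Federer1969, 3.2.22] -/
theorem cross_apply_fderiv_section_comp_complexFrame (hab : p = a + b) (h2 : 2 * a + 2 * b = 2 * p)
    (ℓ : WithLp 2 (V₁ × V₂) →L[ℂ] WithLp 2 (K × V₂)) (hℓ₂ : ∀ z, (ofLp (ℓ z)).2 = (ofLp z).2)
    {W : Set (WithLp 2 (K × V₂))} (hW : IsOpen W) {s : WithLp 2 (K × V₂) → WithLp 2 (V₁ × V₂)}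
    (hs : DifferentiableOn ℂ s W) (hℓs : ∀ w ∈ W, ℓ (s w) = w) {w : WithLp 2 (K × V₂)} (hw : w ∈ W)
    (γ : V₁ [⋀^Fin (2 * a)]→L[ℝ] ℂ) (ν : V₂ [⋀^Fin (2 * b)]→L[ℝ] ℂ) (e' : Fin a → K) (e₂ : Fin b → V₂) :
    ((((γ.compContinuousLinearMap (ContinuousLinearMap.fst ℝ V₁ V₂)).wedge
        (ν.compContinuousLinearMap (ContinuousLinearMap.snd ℝ V₁ V₂))).domDomCongr (finCongr h2)).compContinuousLinearMap
        (WithLp.prodContinuousLinearEquiv 2 ℝ V₁ V₂ : WithLp 2 (V₁ × V₂) →L[ℝ] V₁ × V₂))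
      (⇑(fderiv ℂ s w) ∘ complexFrame
        (Fin.append (fun i ↦ toLp 2 (e' i, (0 : V₂))) (fun j ↦ toLp 2 ((0 : K), e₂ j)) ∘ Fin.cast hab)) =
      γ (fun i ↦ (ofLp (fderiv ℂ s w (toLp 2 (complexFrame e' i, (0 : V₂))))).1) * ν (complexFrame e₂) := by
  set D := fderiv ℂ s w with hD
  have hc : 2 * p = 2 * a + 2 * b := by omega
  have hcf : complexFrame (Fin.append (fun i ↦ toLp 2 (e' i, (0 : V₂))) (fun j ↦ toLp 2 ((0 : K), e₂ j)) ∘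
      Fin.cast hab) = fun k ↦ Fin.append (fun i ↦ toLp 2 (complexFrame e' i, (0 : V₂)))
        (fun j ↦ toLp 2 ((0 : K), complexFrame e₂ j)) (Fin.cast hc k) := by
    funext k
    rw [complexFrame_comp_cast, Function.comp_apply, complexFrame_append]
    exact congrArg _ (Fin.ext rfl)
  have hframe : ((⇑(WithLp.prodContinuousLinearEquiv 2 ℝ V₁ V₂ : WithLp 2 (V₁ × V₂) →L[ℝ] V₁ × V₂) ∘
      (⇑D ∘ complexFrame (Fin.append (fun i ↦ toLp 2 (e' i, (0 : V₂)))
        (fun j ↦ toLp 2 ((0 : K), e₂ j)) ∘ Fin.cast hab))) ∘ ⇑(finCongr h2)) =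
      Fin.append (fun i ↦ ofLp (D (toLp 2 (complexFrame e' i, (0 : V₂)))))
        (fun j ↦ ofLp (D (toLp 2 ((0 : K), complexFrame e₂ j)))) := by
    funext k
    have hk : Fin.cast hc (Fin.cast h2 k) = k := Fin.ext rfl
    simp only [Function.comp_apply, finCongr_apply, hcf, hk, ContinuousLinearEquiv.coe_coe,
      WithLp.prodContinuousLinearEquiv_apply]
    induction k using Fin.addCases with
    | left i => simp only [Fin.append_left]
    | right j => simp only [Fin.append_right]
  rw [ContinuousAlternatingMap.compContinuousLinearMap_apply, ContinuousAlternatingMap.domDomCongr_apply,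
    hframe, wedge_compContinuousLinearMap_apply_append]
  · congr 1
    congr 1
    funext j
    simp only [Function.comp_apply, ContinuousLinearMap.coe_snd']
    rw [snd_fderiv_section_apply ℓ hℓ₂ hW hs hℓs hw]
  · intro i
    rw [ContinuousLinearMap.coe_snd', snd_fderiv_section_apply ℓ hℓ₂ hW hs hℓs hw]

omit [MeasurableSpace V₁] [BorelSpace V₁] [MeasurableSpace V₂] [BorelSpace V₂] [FiniteDimensional ℂ K]
  [MeasurableSpace K] [BorelSpace K] in
/-- The fibre integrand `w ↦ γ((Ds(w)(e′₀, 0))₁, …)` is continuous along the sheet. [folklore] -/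
private theorem continuousOn_cross_fderiv_integrand {W : Set (WithLp 2 (K × V₂))} (hW : IsOpen W)
    {s : WithLp 2 (K × V₂) → WithLp 2 (V₁ × V₂)} (hs : DifferentiableOn ℂ s W)
    (γ : V₁ [⋀^Fin (2 * a)]→L[ℝ] ℂ) (e' : Fin a → K) :
    ContinuousOn (fun w ↦ γ (fun i ↦ (ofLp (fderiv ℂ s w (toLp 2 (complexFrame e' i, (0 : V₂))))).1)) W := by
  have hD : ContinuousOn (fderiv ℂ s) W := Literature.Analysis.Complex.SCV.continuousOn_fderiv hs hW
  refine γ.coe_continuous.comp_continuousOn (continuousOn_pi.2 fun i ↦ ?_)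
  have h1 : Continuous fun z : WithLp 2 (V₁ × V₂) ↦ (ofLp z).1 :=
    continuous_fst.comp (WithLp.prod_continuous_ofLp 2 V₁ V₂)
  exact h1.comp_continuousOn
    (((ContinuousLinearMap.apply ℂ (WithLp 2 (V₁ × V₂))
      (toLp 2 (complexFrame e' i, (0 : V₂)))).continuous).comp_continuousOn hD)

/-- **Integrability of the fibre integrand.** In the setting of `integral_image_section_cross_eq`, if
`g Ω(ξ_T)` is `𝓗^{2p}`-integrable on `s(S)` and `ν(e₂, ie₂, …) ≠ 0`, then
`(x, t) ↦ g(s(x,t)) γ((Ds(x,t)(e′₀,0))₁, …)` is integrable on `{(x, t) : (x, t) ∈ S}` for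
`𝓗^{2a} ⊗ 𝓗^{2b}` (so that Fubini applies). [cite: Federer1969, 3.2.22 and 3.2.23] -/
theorem integrableOn_preimage_toLp_cross_integrand (hp : 0 < p)
    (T : HolomorphicChain 𝓘(ℂ, WithLp 2 (V₁ × V₂)) Ω' p) (hab : p = a + b) (h2 : 2 * a + 2 * b = 2 * p)
    (hK : finrank ℂ K = a) (hV₂ : finrank ℂ V₂ = b)
    (ℓ : WithLp 2 (V₁ × V₂) →L[ℂ] WithLp 2 (K × V₂)) (hℓ₂ : ∀ z, (ofLp (ℓ z)).2 = (ofLp z).2)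
    {W : Set (WithLp 2 (K × V₂))} (hW : IsOpen W) {s : WithLp 2 (K × V₂) → WithLp 2 (V₁ × V₂)}
    (hs : DifferentiableOn ℂ s W) (hℓs : ∀ w ∈ W, ℓ (s w) = w) (hsW : s '' W ⊆ T.carrier)
    (hopen : ∀ t ∈ W, ∃ N ∈ 𝓝 (s t), T.carrier ∩ N ⊆ s '' W)
    (γ : V₁ [⋀^Fin (2 * a)]→L[ℝ] ℂ) (ν : V₂ [⋀^Fin (2 * b)]→L[ℝ] ℂ) (g : WithLp 2 (V₁ × V₂) → ℂ)
    (e' : OrthonormalBasis (Fin a) ℂ K) (e₂ : OrthonormalBasis (Fin b) ℂ V₂)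
    (hν : ν (complexFrame ⇑e₂) ≠ 0) {S : Set (WithLp 2 (K × V₂))} (hSm : MeasurableSet S) (hSW : S ⊆ W)
    (hint : IntegrableOn (fun z ↦ g z *
      ((((γ.compContinuousLinearMap (ContinuousLinearMap.fst ℝ V₁ V₂)).wedge
        (ν.compContinuousLinearMap (ContinuousLinearMap.snd ℝ V₁ V₂))).domDomCongr (finCongr h2)).compContinuousLinearMap
        (WithLp.prodContinuousLinearEquiv 2 ℝ V₁ V₂ : WithLp 2 (V₁ × V₂) →L[ℝ] V₁ × V₂)) (T.orientationFrame z))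
      (s '' S) (μHE[2 * p] : Measure (WithLp 2 (V₁ × V₂)))) :
    IntegrableOn (fun q : K × V₂ ↦ g (s (toLp 2 q)) *
        γ (fun i ↦ (ofLp (fderiv ℂ s (toLp 2 q) (toLp 2 (complexFrame ⇑e' i, (0 : V₂))))).1))
      ((toLp 2) ⁻¹' S) ((μHE[2 * a] : Measure K).prod (μHE[2 * b] : Measure V₂)) := by
  -- the concatenated unitary frame and the sheet formula
  set u : Fin p → WithLp 2 (K × V₂) :=
    Fin.append (fun i ↦ toLp 2 (e' i, (0 : V₂))) (fun j ↦ toLp 2 ((0 : K), e₂ j)) ∘ Fin.cast hab with hu_def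
  have hu : Orthonormal ℂ u :=
    (orthonormal_append_toLp e'.orthonormal e₂.orthonormal).comp _ (Fin.cast_injective hab)
  have hP : finrank ℂ (WithLp 2 (K × V₂)) = p := by
    rw [(WithLp.linearEquiv 2 ℂ (K × V₂)).finrank_eq, Module.finrank_prod, hK, hV₂, hab]
  rw [T.integrableOn_image_section_iff hp hP ℓ hW hs hℓs hsW hopen hu _ g hSm hSW] at hint
  have hpt : EqOn (fun w ↦ (ν (complexFrame ⇑e₂))⁻¹ * (g (s w) *
      ((((γ.compContinuousLinearMap (ContinuousLinearMap.fst ℝ V₁ V₂)).wedge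
        (ν.compContinuousLinearMap (ContinuousLinearMap.snd ℝ V₁ V₂))).domDomCongr (finCongr h2)).compContinuousLinearMap
        (WithLp.prodContinuousLinearEquiv 2 ℝ V₁ V₂ : WithLp 2 (V₁ × V₂) →L[ℝ] V₁ × V₂))
        (⇑(fderiv ℂ s w) ∘ complexFrame u)))
      (fun w ↦ g (s w) * γ (fun i ↦ (ofLp (fderiv ℂ s w (toLp 2 (complexFrame ⇑e' i, (0 : V₂))))).1)) S := by
    intro w hw
    simp only
    rw [hu_def, cross_apply_fderiv_section_comp_complexFrame hab h2 ℓ hℓ₂ hW hs hℓs (hSW hw) γ ν ⇑e' ⇑e₂]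
    field_simp
  have hH : IntegrableOn (fun w ↦ g (s w) *
      γ (fun i ↦ (ofLp (fderiv ℂ s w (toLp 2 (complexFrame ⇑e' i, (0 : V₂))))).1)) S
      (μHE[2 * p] : Measure (WithLp 2 (K × V₂))) := by
    have h1 : IntegrableOn (fun w ↦ (ν (complexFrame ⇑e₂))⁻¹ * (g (s w) *
        ((((γ.compContinuousLinearMap (ContinuousLinearMap.fst ℝ V₁ V₂)).wedge
          (ν.compContinuousLinearMap (ContinuousLinearMap.snd ℝ V₁ V₂))).domDomCongr (finCongr h2)).compContinuousLinearMap
          (WithLp.prodContinuousLinearEquiv 2 ℝ V₁ V₂ : WithLp 2 (V₁ × V₂) →L[ℝ] V₁ × V₂))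
          (⇑(fderiv ℂ s w) ∘ complexFrame u))) S (μHE[2 * p] : Measure (WithLp 2 (K × V₂))) :=
      hint.const_mul _
    exact h1.congr_fun hpt hSm
  -- product decomposition of the measure
  letI : InnerProductSpace ℝ K := InnerProductSpace.complexToReal
  letI : InnerProductSpace ℝ V₂ := InnerProductSpace.complexToReal
  haveI : FiniteDimensional ℝ K := FiniteDimensional.complexToReal K
  haveI : FiniteDimensional ℝ V₂ := FiniteDimensional.complexToReal V₂
  have hK2 : finrank ℝ K = 2 * a := by rw [finrank_real_of_complex, hK]
  have hV22 : finrank ℝ V₂ = 2 * b := by rw [finrank_real_of_complex, hV₂]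
  have hμ : (μHE[2 * p] : Measure (WithLp 2 (K × V₂))) =
      (((μHE[2 * a] : Measure K).prod (μHE[2 * b] : Measure V₂)).map (toLp 2)) := by
    rw [← hK2, ← hV22, map_toLp_prod_euclideanHausdorffMeasure, hK2, hV22, h2]
  rw [hμ, ← MeasurableEquiv.coe_toLp, integrableOn_map_equiv] at hH
  exact hH

/-- **The local coarea formula for a sheet adapted to the product `V₁ ⊞ V₂` (Bochner form).** Let `T` be a
holomorphic `p`-chain on an open subset of `V₁ ⊞ V₂`, `K` a complex inner product space with
`dim K + dim V₂ = a + b = p`, `ℓ : V₁ ⊞ V₂ → K ⊞ V₂` complex-linear with `(ℓ z)₂ = z₂`, and `s` a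
holomorphic section of `ℓ` over the open `W` parametrising a relatively open piece of the carrier. Then
for the cross form `Ω = pr₁^*γ ∧ pr₂^*ν` (`γ ∈ Alt^{2a}(V₁; ℂ)`, `ν ∈ Alt^{2b}(V₂; ℂ)`, read in degree
`2p` on `V₁ ⊞ V₂`), unitary bases `e′` of `K`, `e₂` of `V₂`, a weight `g` and a measurable `S ⊆ W` with
`g Ω(ξ_T)` integrable on `s(S)`:
`∫_{s(S)} g Ω(ξ_T) d𝓗^{2p} = ν(e₂, ie₂, …) · ∫_{t ∈ V₂} ∫_{x : (x,t) ∈ S} g(s(x,t)) γ((Ds(x,t)(e′₀,0))₁, (Ds(x,t)(ie′₀,0))₁, …) d𝓗^{2a}(x) d𝓗^{2b}(t)`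
— the sheet formula of §1 for the concatenated frame, the block evaluation of §2 (`(Ds ζ)₂ = ζ₂`), and
Fubini on `K ⊞ V₂ = K × V₂` (`𝓗^{2p} = 𝓗^{2a} ⊗ 𝓗^{2b}`). This is the chart-level case of the coarea
formula `∫_A f J(pr₂|A) d𝓗^{2p} = ∫_t ∫_{A_t} f d𝓗^{2a} dt` [Federer1969, 3.2.22] for the fibration of a
sheet by the second projection. [cite: Federer1969, 3.2.22 and 3.2.23] [cite: Chirka1989, §14.1 Cor., p. 174] -/
theorem integral_image_section_cross_eq (hp : 0 < p)
    (T : HolomorphicChain 𝓘(ℂ, WithLp 2 (V₁ × V₂)) Ω' p) (hab : p = a + b) (h2 : 2 * a + 2 * b = 2 * p)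
    (hK : finrank ℂ K = a) (hV₂ : finrank ℂ V₂ = b)
    (ℓ : WithLp 2 (V₁ × V₂) →L[ℂ] WithLp 2 (K × V₂)) (hℓ₂ : ∀ z, (ofLp (ℓ z)).2 = (ofLp z).2)
    {W : Set (WithLp 2 (K × V₂))} (hW : IsOpen W) {s : WithLp 2 (K × V₂) → WithLp 2 (V₁ × V₂)}
    (hs : DifferentiableOn ℂ s W) (hℓs : ∀ w ∈ W, ℓ (s w) = w) (hsW : s '' W ⊆ T.carrier)
    (hopen : ∀ t ∈ W, ∃ N ∈ 𝓝 (s t), T.carrier ∩ N ⊆ s '' W)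
    (γ : V₁ [⋀^Fin (2 * a)]→L[ℝ] ℂ) (ν : V₂ [⋀^Fin (2 * b)]→L[ℝ] ℂ) (g : WithLp 2 (V₁ × V₂) → ℂ)
    (e' : OrthonormalBasis (Fin a) ℂ K) (e₂ : OrthonormalBasis (Fin b) ℂ V₂)
    {S : Set (WithLp 2 (K × V₂))} (hSm : MeasurableSet S) (hSW : S ⊆ W)
    (hint : IntegrableOn (fun z ↦ g z *
      ((((γ.compContinuousLinearMap (ContinuousLinearMap.fst ℝ V₁ V₂)).wedge
        (ν.compContinuousLinearMap (ContinuousLinearMap.snd ℝ V₁ V₂))).domDomCongr (finCongr h2)).compContinuousLinearMap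
        (WithLp.prodContinuousLinearEquiv 2 ℝ V₁ V₂ : WithLp 2 (V₁ × V₂) →L[ℝ] V₁ × V₂)) (T.orientationFrame z))
      (s '' S) (μHE[2 * p] : Measure (WithLp 2 (V₁ × V₂)))) :
    ∫ z in s '' S, g z *
        ((((γ.compContinuousLinearMap (ContinuousLinearMap.fst ℝ V₁ V₂)).wedge
          (ν.compContinuousLinearMap (ContinuousLinearMap.snd ℝ V₁ V₂))).domDomCongr (finCongr h2)).compContinuousLinearMap
          (WithLp.prodContinuousLinearEquiv 2 ℝ V₁ V₂ : WithLp 2 (V₁ × V₂) →L[ℝ] V₁ × V₂)) (T.orientationFrame z)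
        ∂(μHE[2 * p] : Measure (WithLp 2 (V₁ × V₂))) =
      ν (complexFrame ⇑e₂) * ∫ t, (∫ x in {x | toLp 2 (x, t) ∈ S}, g (s (toLp 2 (x, t))) *
        γ (fun i ↦ (ofLp (fderiv ℂ s (toLp 2 (x, t)) (toLp 2 (complexFrame ⇑e' i, (0 : V₂))))).1)
          ∂(μHE[2 * a] : Measure K)) ∂(μHE[2 * b] : Measure V₂) := by
  -- the concatenated unitary frame and the sheet formula
  set u : Fin p → WithLp 2 (K × V₂) :=
    Fin.append (fun i ↦ toLp 2 (e' i, (0 : V₂))) (fun j ↦ toLp 2 ((0 : K), e₂ j)) ∘ Fin.cast hab with hu_def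
  have hu : Orthonormal ℂ u :=
    (orthonormal_append_toLp e'.orthonormal e₂.orthonormal).comp _ (Fin.cast_injective hab)
  have hP : finrank ℂ (WithLp 2 (K × V₂)) = p := by
    rw [(WithLp.linearEquiv 2 ℂ (K × V₂)).finrank_eq, Module.finrank_prod, hK, hV₂, hab]
  rw [T.integral_image_section_eq hp hP ℓ hW hs hℓs hsW hopen hu _ g hSm hSW]
  have hpt : EqOn (fun w ↦ g (s w) *
      ((((γ.compContinuousLinearMap (ContinuousLinearMap.fst ℝ V₁ V₂)).wedge
        (ν.compContinuousLinearMap (ContinuousLinearMap.snd ℝ V₁ V₂))).domDomCongr (finCongr h2)).compContinuousLinearMap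
        (WithLp.prodContinuousLinearEquiv 2 ℝ V₁ V₂ : WithLp 2 (V₁ × V₂) →L[ℝ] V₁ × V₂))
        (⇑(fderiv ℂ s w) ∘ complexFrame u))
      (fun w ↦ ν (complexFrame ⇑e₂) * (g (s w) *
        γ (fun i ↦ (ofLp (fderiv ℂ s w (toLp 2 (complexFrame ⇑e' i, (0 : V₂))))).1))) S := by
    intro w hw
    simp only
    rw [hu_def, cross_apply_fderiv_section_comp_complexFrame hab h2 ℓ hℓ₂ hW hs hℓs (hSW hw) γ ν ⇑e' ⇑e₂]
    ring
  rw [setIntegral_congr_fun hSm hpt, integral_const_mul]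
  by_cases hν : ν (complexFrame ⇑e₂) = 0
  · rw [hν, zero_mul, zero_mul]
  congr 1
  -- Fubini on `K ⊞ V₂`
  have hH := T.integrableOn_preimage_toLp_cross_integrand hp hab h2 hK hV₂ ℓ hℓ₂ hW hs hℓs hsW hopen γ ν g
    e' e₂ hν hSm hSW hint
  letI : InnerProductSpace ℝ K := InnerProductSpace.complexToReal
  letI : InnerProductSpace ℝ V₂ := InnerProductSpace.complexToReal
  haveI : FiniteDimensional ℝ K := FiniteDimensional.complexToReal K
  haveI : FiniteDimensional ℝ V₂ := FiniteDimensional.complexToReal V₂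
  have hK2 : finrank ℝ K = 2 * a := by rw [finrank_real_of_complex, hK]
  have hV22 : finrank ℝ V₂ = 2 * b := by rw [finrank_real_of_complex, hV₂]
  have hμ : (μHE[2 * p] : Measure (WithLp 2 (K × V₂))) =
      (((μHE[2 * a] : Measure K).prod (μHE[2 * b] : Measure V₂)).map (toLp 2)) := by
    rw [← hK2, ← hV22, map_toLp_prod_euclideanHausdorffMeasure, hK2, hV22, h2]
  have hS' : MeasurableSet ((toLp 2 : K × V₂ → WithLp 2 (K × V₂)) ⁻¹' S) :=
    hSm.preimage (WithLp.measurable_toLp 2 (K × V₂))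
  haveI : SigmaFinite (μHE[2 * a] : Measure K) := by
    rw [← hK2, InnerProductSpace.euclideanHausdorffMeasure_eq_volume]; infer_instance
  haveI : SigmaFinite (μHE[2 * b] : Measure V₂) := by
    rw [← hV22, InnerProductSpace.euclideanHausdorffMeasure_eq_volume]; infer_instance
  rw [hμ, ← MeasurableEquiv.coe_toLp, setIntegral_map_equiv, MeasurableEquiv.coe_toLp,
    ← integral_indicator hS', integral_prod_symm _ ((integrable_indicator_iff hS').2 hH)]
  congr 1
  funext t
  have hSt : MeasurableSet {x : K | toLp 2 (x, t) ∈ S} := hS'.preimage measurable_prodMk_right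
  have hind : (fun x : K ↦ ((toLp 2 : K × V₂ → WithLp 2 (K × V₂)) ⁻¹' S).indicator (fun q : K × V₂ ↦
      g (s (toLp 2 q)) * γ (fun i ↦ (ofLp (fderiv ℂ s (toLp 2 q) (toLp 2 (complexFrame ⇑e' i, (0 : V₂))))).1))
        (x, t)) = {x : K | toLp 2 (x, t) ∈ S}.indicator (fun x ↦ g (s (toLp 2 (x, t))) *
      γ (fun i ↦ (ofLp (fderiv ℂ s (toLp 2 (x, t)) (toLp 2 (complexFrame ⇑e' i, (0 : V₂))))).1)) := by
    funext x
    rfl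
  rw [hind, integral_indicator hSt]

/-- **The local coarea formula, `∫⁻` form with extended norms**: for measurable `G : V₁ ⊞ V₂ → [0, ∞]`,
`∫⁻_{s(S)} G ‖Ω(ξ_T)‖ₑ d𝓗^{2p} = ‖ν(e₂, ie₂, …)‖ₑ ∫⁻_t ∫⁻_{x : (x,t) ∈ S} G(s(x,t)) ‖γ((Ds(x,t)(e′₀,0))₁, …)‖ₑ d𝓗^{2a} d𝓗^{2b}`
(Tonelli; no integrability needed). [cite: Federer1969, 3.2.22 and 3.2.23] -/
theorem lintegral_image_section_cross_eq_enorm (hp : 0 < p)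
    (T : HolomorphicChain 𝓘(ℂ, WithLp 2 (V₁ × V₂)) Ω' p) (hab : p = a + b) (h2 : 2 * a + 2 * b = 2 * p)
    (hK : finrank ℂ K = a) (hV₂ : finrank ℂ V₂ = b)
    (ℓ : WithLp 2 (V₁ × V₂) →L[ℂ] WithLp 2 (K × V₂)) (hℓ₂ : ∀ z, (ofLp (ℓ z)).2 = (ofLp z).2)
    {W : Set (WithLp 2 (K × V₂))} (hW : IsOpen W) {s : WithLp 2 (K × V₂) → WithLp 2 (V₁ × V₂)}
    (hs : DifferentiableOn ℂ s W) (hℓs : ∀ w ∈ W, ℓ (s w) = w) (hsW : s '' W ⊆ T.carrier)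
    (hopen : ∀ t ∈ W, ∃ N ∈ 𝓝 (s t), T.carrier ∩ N ⊆ s '' W)
    (γ : V₁ [⋀^Fin (2 * a)]→L[ℝ] ℂ) (ν : V₂ [⋀^Fin (2 * b)]→L[ℝ] ℂ) {G : WithLp 2 (V₁ × V₂) → ℝ≥0∞}
    (hG : Measurable G) (e' : OrthonormalBasis (Fin a) ℂ K) (e₂ : OrthonormalBasis (Fin b) ℂ V₂)
    {S : Set (WithLp 2 (K × V₂))} (hSm : MeasurableSet S) (hSW : S ⊆ W) :
    ∫⁻ z in s '' S, G z *
        ‖((((γ.compContinuousLinearMap (ContinuousLinearMap.fst ℝ V₁ V₂)).wedge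
          (ν.compContinuousLinearMap (ContinuousLinearMap.snd ℝ V₁ V₂))).domDomCongr (finCongr h2)).compContinuousLinearMap
          (WithLp.prodContinuousLinearEquiv 2 ℝ V₁ V₂ : WithLp 2 (V₁ × V₂) →L[ℝ] V₁ × V₂)) (T.orientationFrame z)‖ₑ
        ∂(μHE[2 * p] : Measure (WithLp 2 (V₁ × V₂))) =
      ‖ν (complexFrame ⇑e₂)‖ₑ * ∫⁻ t, (∫⁻ x in {x | toLp 2 (x, t) ∈ S}, G (s (toLp 2 (x, t))) *
        ‖γ (fun i ↦ (ofLp (fderiv ℂ s (toLp 2 (x, t)) (toLp 2 (complexFrame ⇑e' i, (0 : V₂))))).1)‖ₑ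
          ∂(μHE[2 * a] : Measure K)) ∂(μHE[2 * b] : Measure V₂) := by
  -- the concatenated unitary frame and the sheet formula
  set u : Fin p → WithLp 2 (K × V₂) :=
    Fin.append (fun i ↦ toLp 2 (e' i, (0 : V₂))) (fun j ↦ toLp 2 ((0 : K), e₂ j)) ∘ Fin.cast hab with hu_def
  have hu : Orthonormal ℂ u :=
    (orthonormal_append_toLp e'.orthonormal e₂.orthonormal).comp _ (Fin.cast_injective hab)
  have hP : finrank ℂ (WithLp 2 (K × V₂)) = p := by
    rw [(WithLp.linearEquiv 2 ℂ (K × V₂)).finrank_eq, Module.finrank_prod, hK, hV₂, hab]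
  rw [T.lintegral_image_section_eq_enorm hp hP ℓ hW hs hℓs hsW hopen hu _ G hSm hSW]
  have hpt : EqOn (fun w ↦ G (s w) *
      ‖((((γ.compContinuousLinearMap (ContinuousLinearMap.fst ℝ V₁ V₂)).wedge
        (ν.compContinuousLinearMap (ContinuousLinearMap.snd ℝ V₁ V₂))).domDomCongr (finCongr h2)).compContinuousLinearMap
        (WithLp.prodContinuousLinearEquiv 2 ℝ V₁ V₂ : WithLp 2 (V₁ × V₂) →L[ℝ] V₁ × V₂))
        (⇑(fderiv ℂ s w) ∘ complexFrame u)‖ₑ)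
      (fun w ↦ ‖ν (complexFrame ⇑e₂)‖ₑ * (G (s w) *
        ‖γ (fun i ↦ (ofLp (fderiv ℂ s w (toLp 2 (complexFrame ⇑e' i, (0 : V₂))))).1)‖ₑ)) S := by
    intro w hw
    simp only
    rw [hu_def, cross_apply_fderiv_section_comp_complexFrame hab h2 ℓ hℓ₂ hW hs hℓs (hSW hw) γ ν ⇑e' ⇑e₂,
      enorm_mul]
    ring
  rw [setLIntegral_congr_fun hSm hpt, lintegral_const_mul' _ _ enorm_ne_top]
  congr 1
  -- Tonelli on `K ⊞ V₂`
  letI : InnerProductSpace ℝ K := InnerProductSpace.complexToReal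
  letI : InnerProductSpace ℝ V₂ := InnerProductSpace.complexToReal
  haveI : FiniteDimensional ℝ K := FiniteDimensional.complexToReal K
  haveI : FiniteDimensional ℝ V₂ := FiniteDimensional.complexToReal V₂
  have hK2 : finrank ℝ K = 2 * a := by rw [finrank_real_of_complex, hK]
  have hV22 : finrank ℝ V₂ = 2 * b := by rw [finrank_real_of_complex, hV₂]
  have hμ : (μHE[2 * p] : Measure (WithLp 2 (K × V₂))) =
      (((μHE[2 * a] : Measure K).prod (μHE[2 * b] : Measure V₂)).map (toLp 2)) := by
    rw [← hK2, ← hV22, map_toLp_prod_euclideanHausdorffMeasure, hK2, hV22, h2]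
  have hS' : MeasurableSet ((toLp 2 : K × V₂ → WithLp 2 (K × V₂)) ⁻¹' S) :=
    hSm.preimage (WithLp.measurable_toLp 2 (K × V₂))
  haveI : SigmaFinite (μHE[2 * a] : Measure K) := by
    rw [← hK2, InnerProductSpace.euclideanHausdorffMeasure_eq_volume]; infer_instance
  haveI : SigmaFinite (μHE[2 * b] : Measure V₂) := by
    rw [← hV22, InnerProductSpace.euclideanHausdorffMeasure_eq_volume]; infer_instance
  -- measurability of the fibre integrand
  have hcont : ContinuousOn (fun q : K × V₂ ↦ s (toLp 2 q)) ((toLp 2) ⁻¹' S) :=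
    (hs.continuousOn.mono hSW).comp (WithLp.prod_continuous_toLp 2 K V₂).continuousOn fun _ h ↦ h
  have hcontγ : ContinuousOn (fun q : K × V₂ ↦
      γ (fun i ↦ (ofLp (fderiv ℂ s (toLp 2 q) (toLp 2 (complexFrame ⇑e' i, (0 : V₂))))).1))
      ((toLp 2) ⁻¹' S) :=
    ((continuousOn_cross_fderiv_integrand hW hs γ ⇑e').mono hSW).comp
      (WithLp.prod_continuous_toLp 2 K V₂).continuousOn fun _ h ↦ h
  have hAEM : AEMeasurable (((toLp 2 : K × V₂ → WithLp 2 (K × V₂)) ⁻¹' S).indicator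
      (fun q : K × V₂ ↦ G (s (toLp 2 q)) *
        ‖γ (fun i ↦ (ofLp (fderiv ℂ s (toLp 2 q) (toLp 2 (complexFrame ⇑e' i, (0 : V₂))))).1)‖ₑ))
      ((μHE[2 * a] : Measure K).prod (μHE[2 * b] : Measure V₂)) :=
    (aemeasurable_indicator_iff hS').2
      ((hG.comp_aemeasurable (hcont.aemeasurable hS')).mul (hcontγ.aemeasurable hS').enorm)
  rw [hμ, ← MeasurableEquiv.coe_toLp, (MeasurableEquiv.toLp 2 (K × V₂)).measurableEmbedding.restrict_map,
    lintegral_map_equiv, MeasurableEquiv.coe_toLp, ← lintegral_indicator hS', lintegral_prod_symm _ hAEM]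
  congr 1
  funext t
  have hSt : MeasurableSet {x : K | toLp 2 (x, t) ∈ S} := hS'.preimage measurable_prodMk_right
  have hind : (fun x : K ↦ ((toLp 2 : K × V₂ → WithLp 2 (K × V₂)) ⁻¹' S).indicator (fun q : K × V₂ ↦
      G (s (toLp 2 q)) * ‖γ (fun i ↦ (ofLp (fderiv ℂ s (toLp 2 q) (toLp 2 (complexFrame ⇑e' i, (0 : V₂))))).1)‖ₑ)
        (x, t)) = {x : K | toLp 2 (x, t) ∈ S}.indicator (fun x ↦ G (s (toLp 2 (x, t))) *
      ‖γ (fun i ↦ (ofLp (fderiv ℂ s (toLp 2 (x, t)) (toLp 2 (complexFrame ⇑e' i, (0 : V₂))))).1)‖ₑ) := by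
    funext x
    rfl
  rw [hind, lintegral_indicator hSt]

/-! ### §4 Slices of an adapted sheet -/

omit [FiniteDimensional ℂ V₁] [MeasurableSpace V₁] [BorelSpace V₁] [FiniteDimensional ℂ V₂] [MeasurableSpace V₂]
  [BorelSpace V₂] [FiniteDimensional ℂ K] [MeasurableSpace K] [BorelSpace K] in
/-- A section of a map preserving the second coordinate preserves it: `(s w)₂ = w₂`. [folklore] -/
private theorem snd_section_eq (ℓ : WithLp 2 (V₁ × V₂) →L[ℂ] WithLp 2 (K × V₂))
    (hℓ₂ : ∀ z, (ofLp (ℓ z)).2 = (ofLp z).2) {W : Set (WithLp 2 (K × V₂))}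
    {s : WithLp 2 (K × V₂) → WithLp 2 (V₁ × V₂)} (hℓs : ∀ w ∈ W, ℓ (s w) = w)
    {w : WithLp 2 (K × V₂)} (hw : w ∈ W) : (ofLp (s w)).2 = (ofLp w).2 := by
  rw [← hℓ₂ (s w), hℓs w hw]

omit [FiniteDimensional ℂ V₁] [MeasurableSpace V₁] [BorelSpace V₁] [FiniteDimensional ℂ V₂] [MeasurableSpace V₂]
  [BorelSpace V₂] [FiniteDimensional ℂ K] [MeasurableSpace K] [BorelSpace K] in
/-- **The slices of a sheet are the images of the slice sections**: for `t ∈ V₂`,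
`{x : (x, t) ∈ s(S)} = s_t(S_t)` with `s_t(x′) = (s(x′, t))₁` and `S_t = {x′ : (x′, t) ∈ S}`.
[cite: Federer1969, 3.2.22] -/
theorem slice_image_section_eq (ℓ : WithLp 2 (V₁ × V₂) →L[ℂ] WithLp 2 (K × V₂))
    (hℓ₂ : ∀ z, (ofLp (ℓ z)).2 = (ofLp z).2) {W : Set (WithLp 2 (K × V₂))}
    {s : WithLp 2 (K × V₂) → WithLp 2 (V₁ × V₂)} (hℓs : ∀ w ∈ W, ℓ (s w) = w)
    {S : Set (WithLp 2 (K × V₂))} (hSW : S ⊆ W) (t : V₂) :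
    {x : V₁ | toLp 2 (x, t) ∈ s '' S} =
      (fun x' : K ↦ (ofLp (s (toLp 2 (x', t)))).1) '' {x' : K | toLp 2 (x', t) ∈ S} := by
  ext x
  simp only [mem_setOf_eq, mem_image]
  constructor
  · rintro ⟨w, hwS, hwx⟩
    have hw2 : (ofLp w).2 = t := by
      rw [← snd_section_eq ℓ hℓ₂ hℓs (hSW hwS), hwx]
    have hw : w = toLp 2 ((ofLp w).1, t) := by rw [← hw2]
    refine ⟨(ofLp w).1, by rwa [← hw], ?_⟩
    rw [← hw, hwx]
  · rintro ⟨x', hx'S, rfl⟩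
    refine ⟨toLp 2 (x', t), hx'S, ?_⟩
    have h2 : (ofLp (s (toLp 2 (x', t)))).2 = t := snd_section_eq ℓ hℓ₂ hℓs (hSW hx'S)
    have key : ∀ z : WithLp 2 (V₁ × V₂), z = toLp 2 ((ofLp z).1, (ofLp z).2) := fun z ↦ rfl
    exact (key _).trans (by rw [h2])

omit [FiniteDimensional ℂ V₁] [MeasurableSpace V₁] [BorelSpace V₁] [FiniteDimensional ℂ V₂] [MeasurableSpace V₂]
  [BorelSpace V₂] [FiniteDimensional ℂ K] [MeasurableSpace K] [BorelSpace K] in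
/-- **The differential of a slice section**: for `(x, t) ∈ W`, the slice section
`s_t : x′ ↦ (s(x′, t))₁` is complex-differentiable at `x` with
`D s_t(x) h = (Ds(x, t)(h, 0))₁` (chain rule; the slices of a `C¹` parametrisation adapted to a
fibration are `C¹` parametrisations of the fibres). [cite: Federer1969, 3.2.22 (slices of a rectifiable set)] -/
theorem hasFDerivAt_slice_section {W : Set (WithLp 2 (K × V₂))} (hW : IsOpen W)
    {s : WithLp 2 (K × V₂) → WithLp 2 (V₁ × V₂)} (hs : DifferentiableOn ℂ s W) {t : V₂} {x : K}
    (hx : toLp 2 (x, t) ∈ W) :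
    HasFDerivAt (fun x' : K ↦ (ofLp (s (toLp 2 (x', t)))).1)
      ((ContinuousLinearMap.fst ℂ V₁ V₂).comp
        ((WithLp.prodContinuousLinearEquiv 2 ℂ V₁ V₂ : WithLp 2 (V₁ × V₂) →L[ℂ] V₁ × V₂).comp
          ((fderiv ℂ s (toLp 2 (x, t))).comp
            (((WithLp.prodContinuousLinearEquiv 2 ℂ K V₂).symm : K × V₂ →L[ℂ] WithLp 2 (K × V₂)).comp
              (ContinuousLinearMap.inl ℂ K V₂))))) x := by
  have h0 : HasFDerivAt (fun x' : K ↦ toLp 2 (x', t))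
      ((((WithLp.prodContinuousLinearEquiv 2 ℂ K V₂).symm : K × V₂ →L[ℂ] WithLp 2 (K × V₂)).comp
        (ContinuousLinearMap.inl ℂ K V₂))) x :=
    ((WithLp.prodContinuousLinearEquiv 2 ℂ K V₂).symm : K × V₂ →L[ℂ] WithLp 2 (K × V₂)).hasFDerivAt.comp x
      (hasFDerivAt_prodMk_left x t)
  have h1 : HasFDerivAt s (fderiv ℂ s (toLp 2 (x, t))) (toLp 2 (x, t)) :=
    (hs.differentiableAt (hW.mem_nhds hx)).hasFDerivAt
  have h2 : HasFDerivAt (fun z : WithLp 2 (V₁ × V₂) ↦ (ofLp z).1)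
      ((ContinuousLinearMap.fst ℂ V₁ V₂).comp
        (WithLp.prodContinuousLinearEquiv 2 ℂ V₁ V₂ : WithLp 2 (V₁ × V₂) →L[ℂ] V₁ × V₂)) (s (toLp 2 (x, t))) :=
    (ContinuousLinearMap.fst ℂ V₁ V₂).hasFDerivAt.comp _
      (WithLp.prodContinuousLinearEquiv 2 ℂ V₁ V₂ : WithLp 2 (V₁ × V₂) →L[ℂ] V₁ × V₂).hasFDerivAt
  have := h2.comp x (h1.comp x h0)
  simpa only [ContinuousLinearMap.comp_assoc, Function.comp_def] using this

omit [FiniteDimensional ℂ V₁] [MeasurableSpace V₁] [BorelSpace V₁] [FiniteDimensional ℂ V₂] [MeasurableSpace V₂]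
  [BorelSpace V₂] [FiniteDimensional ℂ K] [MeasurableSpace K] [BorelSpace K] in
/-- The slice section is holomorphic on the slice of `W`, with `D s_t(x) h = (Ds(x, t)(h, 0))₁`.
[cite: Federer1969, 3.2.22 (slices of a rectifiable set)] -/
theorem differentiableOn_slice_section {W : Set (WithLp 2 (K × V₂))} (hW : IsOpen W)
    {s : WithLp 2 (K × V₂) → WithLp 2 (V₁ × V₂)} (hs : DifferentiableOn ℂ s W) (t : V₂) :
    DifferentiableOn ℂ (fun x' : K ↦ (ofLp (s (toLp 2 (x', t)))).1) {x : K | toLp 2 (x, t) ∈ W} ∧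
      ∀ x : K, toLp 2 (x, t) ∈ W → ∀ h : K,
        fderiv ℂ (fun x' : K ↦ (ofLp (s (toLp 2 (x', t)))).1) x h =
          (ofLp (fderiv ℂ s (toLp 2 (x, t)) (toLp 2 (h, (0 : V₂))))).1 := by
  refine ⟨fun x hx ↦ (hasFDerivAt_slice_section hW hs hx).differentiableAt.differentiableWithinAt,
    fun x hx h ↦ ?_⟩
  rw [(hasFDerivAt_slice_section hW hs hx).fderiv]
  simp

end HolomorphicChain

end Literature.Geometry.Kaehler

end
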